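import Summits.QuantumFields.YangMills.Theorems.FluctuationComparisonRegPrIntLS2BetaChartReadDerivBkgLipschitzKStep
import HarnessLib

/-!
# S2β · (REG-UP)′ letter (hNL) CLOSED FORM — «THE SECOND-ORDER SUP REMAINDER OF THE k-STEP TOWER BY SEGMENT ROWS, INSTANTIATED»: for a tower of lie-valued data `Xd i` on `F.P K` whose
# one-step second-order remainders are `‖↑(Xd (i+1) c′) − ↑(Dψ_{Ū^iU₀}(Xd i) c′)‖ ≤ r (i+1)`, the k-step remainder about `U₀` is `‖↑(Xd k c) − ↑(DΨ^{U₀}_k (Xd 0) c)‖ ≤ Σ_{i<k} Λ·L^{k−1−i}·r(i+1)`,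
# `Λ = (1+4(d+2))·exp(C·Σ_{j<k} α_j)` — px13 g29's ✓p840433 `norm_sub_segment_le` shape with the segment maps, rows and chain-rule identities ALL INHABITED (✓p840392 rows, ✓β3c segment chain rule)

Cell `ym3-torus` (YM ladder rung R3 = continuum `SU(2)` Yang–Mills on the three-torus at fixed lattice data — a RUNG: NOT d = 4, NOT infinite volume, NOT a mass gap,
NOT Clay).  Width seat «width 12» `ym3-torus-px12` (gen 27); crux `stmt-QuantumFields-20520`, LINE g18-1 S2β, node (REG-UP)′ (the (hNL) letter of ✓p840162 `hOSC_of_compositeLetters`).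
`--kind proof --supports stmt-QuantumFields-20520 --as helper`, count-neutral, DEFINITION-FREE (0 `def`, 0 `instance`, 0 `notation`, 0 `sorry`, default heartbeats).  `SU(N)`, towers `F.P K`, `k ≤ m + K`.

WHAT IS PROVED (sorry-free; the sum identity is the TOP-peeling telescope `Xd k − DΨ_k(Xd 0) = Σ_{i<k} DΨ^{Ū^{i+1}U₀}_{i+1,k−1−i}(Xd (i+1) − Dψ_{Ū^iU₀}(Xd i))`, casts by `subst` + lit ✓`bondShift_refl`).
§1 `rterm_top`, `rterm_diag` (the two term identities, as in ✓β3c); §2 ★★`sub_fderiv_chartRead_iter_eq_sum` — the sum identity; §3 ★★★**`norm_sub_fderiv_chartRead_iter_le`** —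
`‖↑(Xd k c) − ↑((DΨ^{U₀}_k (Xd 0)) c)‖ ≤ Σ_{i<k} Λ·L^{k−1−i}·r(i+1)` under the loop guards `α` below `k` and `0 ≤ r`.

HONEST SCOPE.  Chain-rule bookkeeping over landed rows; nothing of Bałaban's renormalisation-group analysis proved ([Balaban1985Averaging] Prop. 4 (128)–(131) pp.37–38 is the printed locus); the one-step
second-order remainders `r` are HYPOTHESES (M-1‴∕C₆∕C₇ lineage, px20 g25 ✓p840xxx `RemainderRowClass`); (REG-UP)′ assembly∕GAP♯∘ (`stub_uniformFibreGapOrbit`, registry 3732b7df UNTOUCHED, 0∕5), the five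
registered stubs, S2β, crux 20520, 19936, 19200, `YM3TorusSU2` — NOT proved; rung R3 — NOT d = 4, NOT infinite volume, NOT a mass gap, NOT Clay; the Yang–Mills mass gap is NOT proved.
-/

set_option autoImplicit false

noncomputable section

open scoped Matrix.Norms.L2Operator Topology
open Filter Set Function

namespace Summit.QuantumFields.YangMills.Theorems.FluctuationComparisonRegPrIntLS2BetaSecondOrderTowerSupClosed

open Literature.MathematicalPhysics.QuantumFieldTheory.Balaban1983to89
open Literature.MathematicalPhysics.QuantumFieldTheory.Balaban1983to89.HaarExponentialChart
open Literature.MathematicalPhysics.QuantumFieldTheory.Balaban1983to89.HaarExponentialChart.IsChartRep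
open Literature.MathematicalPhysics.QuantumFieldTheory.Balaban1983to89.BlockAveraging (Small Idx avgFun loopHol blockAvg blockAvg_avg)
open Literature.MathematicalPhysics.QuantumFieldTheory.Balaban1983to89.ExpMeanLog (expMeanLogSU deltaSU)
open Literature.MathematicalPhysics.QuantumFieldTheory.Balaban1983to89.Node00
open Literature.MathematicalPhysics.QuantumFieldTheory.Balaban1983to89.T3ContinuumYM3Torus
open Literature.MathematicalPhysics.QuantumFieldTheory.Balaban1983to89.T3LevelShift
open Literature.MathematicalPhysics.QuantumFieldTheory.Balaban1983to89.T4AvgSensitivity (iterFrom iter_add)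
open Summit.QuantumFields.YangMills.BalabanUVNodes.N09ChartReadAveragingSmooth
open Summit.QuantumFields.YangMills.Theorems.FluctuationComparisonRegPrIntLS2BetaChartReadDescentChainRule (fderiv_chartRead_iter_succ_apply fderiv_chartRead_iter_zero)
open Summit.QuantumFields.YangMills.Theorems.FluctuationComparisonRegPrIntLS2BetaChartReadIterFromSup (norm_fderiv_chartReadFrom_apply_le_exp)
open Summit.QuantumFields.YangMills.Theorems.FluctuationComparisonRegPrIntLS2BetaChartReadIterFromChainRule (fderiv_chartReadFrom_succ fderiv_chartReadFrom_zero)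
open Summit.QuantumFields.YangMills.Theorems.FluctuationComparisonRegPrIntLS2BetaChartReadDerivBkgLipschitzKStep
  (bondShift_symm_refl seg_cast seg_zero_symm_apply fderiv_one_natural_refl smallBelow_of_guards sum_shift_le rowConst_mono)

variable {N : ℕ} [NeZero N] (F : T3Family)

/-! ## §1 The two term identities -/

/-- ★ The top step of a remainder term (`i < k`): `Dψ_{Ū^kU₀} (rterm i k) = rterm i (k+1)` (segment top recursion ✓`fderiv_chartReadFrom_succ` through the in-tower reindexing). [cite: Balaban1987RG1, (0.11) p.253; Balaban1985Averaging, Prop. 4 (127) p.37] -/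
theorem rterm_top {K k i : ℕ} (hk : k + 1 ≤ F.m + K) (hik : i < k) (U₀ : GaugeField (F.P K) 0 (SU N)) {α : ℕ → ℝ}
    (hαδ : ∀ l, α l < deltaSU (Fin N)) (hαU : (∀ l, l < (k + 1) → ∀ (c : PBond (F.P K) (l + 1)) (idx : Idx (F.P K)), dist1 (loopHol (Averaging.iter (fun i => blockAvg (P := F.P K) (j := i) (expMeanLogSU (n := Fin N))) l U₀) c idx) ≤ α l))
    (Xd : (i : ℕ) → (PBond (F.P K) i → (specialUnitaryLogChart (Fin N)).lie)) :
    (fderiv ℝ (fun (B : PBond (F.P K) k → (specialUnitaryLogChart (Fin N)).lie) (c' : PBond (F.P K) (k + 1)) => (isChartRep_specialUnitaryGroup (n := Fin N)).logChart (avgFun (expMeanLogSU (n := Fin N)) (fun c => (isChartRep_specialUnitaryGroup (n := Fin N)).expChart (B c) * (Averaging.iter (fun i => blockAvg (P := F.P K) (j := i) (expMeanLogSU (n := Fin N))) k U₀) c) c' * (avgFun (expMeanLogSU (n := Fin N)) ((Averaging.iter (fun i => blockAvg (P := F.P K) (j := i) (expMeanLogSU (n := Fin N))) k U₀)) c')⁻¹))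 0) ((if _h : i < k then (fun c : PBond (F.P K) k => ((fderiv ℝ (fun (A : PBond (F.P K) (i + 1) → (specialUnitaryLogChart (Fin N)).lie) (c : PBond (F.P K) ((i + 1) + (k - 1 - i))) => (isChartRep_specialUnitaryGroup (n := Fin N)).logChart (iterFrom (fun i => blockAvg (P := F.P K) (j := i) (expMeanLogSU (n := Fin N))) (i + 1) (k - 1 - i) (fun b : PBond (F.P K) (i + 1) => (isChartRep_specialUnitaryGroup (n := Fin N)).expChart (A b) * (Averaging.iter (fun i => blockAvg (P := F.P K) (j := i) (expMeanLogSU (n := Fin N))) (i + 1) U₀) b) c * (iterFrom (fun i => blockAvg (P := F.P K) (j := i) (expMeanLogSU (n := Fin N))) (i + 1) (k - 1 - i) ((Averaging.iter (fun i => blockAvg (P := F.P K) (j := i) (expMeanLogSU (n := Fin N))) (i + 1) U₀)) c)⁻¹)) 0) ((Xd (i + 1) - (fderiv ℝ (fun (B : PBond (F.P K) i → (specialUnitaryLogChart (Fin N)).lie) (c' : PBond (F.P K) (i + 1)) => (isChartRep_specialUnitaryGroup (n := Fin N)).logChart (avgFun (expMeanLogSU (n := Fin N)) (fun c => (isChartRep_specialUnitaryGroup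 (n := Fin N)).expChart (B c) * (Averaging.iter (fun i => blockAvg (P := F.P K) (j := i) (expMeanLogSU (n := Fin N))) i U₀) c) c' * (avgFun (expMeanLogSU (n := Fin N)) ((Averaging.iter (fun i => blockAvg (P := F.P K) (j := i) (expMeanLogSU (n := Fin N))) i U₀)) c')⁻¹)) 0) (Xd i)))) ((bondShift (F.sitesPerDir_eq (m := F.m) (K := K) (j := (i + 1 + (k - 1 - i))) (m' := F.m) (K' := K) (j' := k) (by omega))).symm c)) else (0 : PBond (F.P K) k → (specialUnitaryLogChart (Fin N)).lie))) = (if _h : i < (k + 1) then (fun c : PBond (F.P K) (k + 1) => ((fderiv ℝ (fun (A : PBond (F.P K) (i + 1) → (specialUnitaryLogChart (Fin N)).lie) (c : PBond (F.P K) ((i + 1) + ((k + 1) - 1 - i))) => (isChartRep_specialUnitaryGroup (n := Fin N)).logChart (iterFrom (fun i => blockAvg (P := F.P K) (j := i) (expMeanLogSU (n := Fin N))) (i + 1) ((k + 1) - 1 - i) (fun b : PBond (F.P K) (i + 1) => (isChartRep_specialUnitaryGroup (n := Fin N)).expChart (A b) * (Averaging.iter (fun i => blockAvg (P := F.P K)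 (j := i) (expMeanLogSU (n := Fin N))) (i + 1) U₀) b) c * (iterFrom (fun i => blockAvg (P := F.P K) (j := i) (expMeanLogSU (n := Fin N))) (i + 1) ((k + 1) - 1 - i) ((Averaging.iter (fun i => blockAvg (P := F.P K) (j := i) (expMeanLogSU (n := Fin N))) (i + 1) U₀)) c)⁻¹)) 0) ((Xd (i + 1) - (fderiv ℝ (fun (B : PBond (F.P K) i → (specialUnitaryLogChart (Fin N)).lie) (c' : PBond (F.P K) (i + 1)) => (isChartRep_specialUnitaryGroup (n := Fin N)).logChart (avgFun (expMeanLogSU (n := Fin N)) (fun c => (isChartRep_specialUnitaryGroup (n := Fin N)).expChart (B c) * (Averaging.iter (fun i => blockAvg (P := F.P K) (j := i) (expMeanLogSU (n := Fin N))) i U₀) c) c' * (avgFun (expMeanLogSU (n := Fin N)) ((Averaging.iter (fun i => blockAvg (P := F.P K) (j := i) (expMeanLogSU (n := Fin N))) i U₀)) c')⁻¹)) 0) (Xd i)))) ((bondShift (F.sitesPerDir_eq (m := F.m) (K := K) (j := (i + 1 + ((k + 1) - 1 - i))) (m' := F.m) (K' := K) (j' := (k + 1)) (by omega))).symm c)) else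 (0 : PBond (F.P K) (k + 1) → (specialUnitaryLogChart (Fin N)).lie)) := by
  have hik' : i < k + 1 := Nat.lt_succ_of_lt hik
  rw [dif_pos hik, dif_pos hik']
  rw [fderiv_one_natural_refl F (k := k) (k' := i + 1 + (k - 1 - i)) (by omega) U₀
    (F.sitesPerDir_eq (m := F.m) (K := K) (j := (i + 1 + (k - 1 - i))) (m' := F.m) (K' := K) (j' := k) (by omega)) (F.sitesPerDir_eq (m := F.m) (K := K) (j := (i + 1 + (k - 1 - i) + 1)) (m' := F.m) (K' := K) (j' := (k + 1)) (by omega))]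
  have hseg := fderiv_chartReadFrom_succ (N := N) F (K := K) (k₀ := i + 1) (n := k - 1 - i) (by omega) ((Averaging.iter (fun i => blockAvg (P := F.P K) (j := i) (expMeanLogSU (n := Fin N))) (i + 1) U₀)) (α := fun j => α (i + 1 + j))
    (fun j => hαδ (i + 1 + j))
    (fun j hj c idx => by
      rw [← iter_add]
      exact hαU (i + 1 + j) (by omega) c idx)
  rw [seg_cast F (j := i + 1) (kk := k + 1) (n := k - 1 - i) (n' := k + 1 - 1 - i) (by omega) ((Averaging.iter (fun i => blockAvg (P := F.P K) (j := i) (expMeanLogSU (n := Fin N))) (i + 1) U₀)) _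
    (F.sitesPerDir_eq (m := F.m) (K := K) (j := (i + 1 + (k + 1 - 1 - i))) (m' := F.m) (K' := K) (j' := (k + 1)) (by omega)) (F.sitesPerDir_eq (m := F.m) (K := K) (j := (i + 1 + (k - 1 - i + 1))) (m' := F.m) (K' := K) (j' := (k + 1)) (by omega))]
  funext c
  rw [hseg, ContinuousLinearMap.comp_apply, iter_add (fun i => blockAvg (P := F.P K) (j := i) (expMeanLogSU (n := Fin N))) (i + 1) (k - 1 - i) U₀]

/-- ★ The diagonal remainder term `rterm k (k+1) = Xd (k+1) − Dψ_{Ū^kU₀}(Xd k)`. [cite: Balaban1987RG1, (0.11) p.253] -/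
theorem rterm_diag {K k : ℕ} (hk : k + 1 ≤ F.m + K) (U₀ : GaugeField (F.P K) 0 (SU N)) (Xd : (i : ℕ) → (PBond (F.P K) i → (specialUnitaryLogChart (Fin N)).lie)) :
    (if _h : k < (k + 1) then (fun c : PBond (F.P K) (k + 1) => ((fderiv ℝ (fun (A : PBond (F.P K) (k + 1) → (specialUnitaryLogChart (Fin N)).lie) (c : PBond (F.P K) ((k + 1) + ((k + 1) - 1 - k))) => (isChartRep_specialUnitaryGroup (n := Fin N)).logChart (iterFrom (fun i => blockAvg (P := F.P K) (j := i) (expMeanLogSU (n := Fin N))) (k + 1) ((k + 1) - 1 - k) (fun b : PBond (F.P K) (k + 1) => (isChartRep_specialUnitaryGroup (n := Fin N)).expChart (A b) * (Averaging.iter (fun i => blockAvg (P := F.P K) (j := i) (expMeanLogSU (n := Fin N))) (k + 1) U₀) b) c * (iterFrom (fun i => blockAvg (P := F.P K) (j := i) (expMeanLogSU (n := Fin N))) (k + 1) ((k + 1) - 1 - k) ((Averaging.iter (fun i => blockAvg (P := F.P K) (j := i) (expMeanLogSU (n := Fin N))) (k + 1) U₀)) c)⁻¹)) 0) ((Xd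 (k + 1) - (fderiv ℝ (fun (B : PBond (F.P K) k → (specialUnitaryLogChart (Fin N)).lie) (c' : PBond (F.P K) (k + 1)) => (isChartRep_specialUnitaryGroup (n := Fin N)).logChart (avgFun (expMeanLogSU (n := Fin N)) (fun c => (isChartRep_specialUnitaryGroup (n := Fin N)).expChart (B c) * (Averaging.iter (fun i => blockAvg (P := F.P K) (j := i) (expMeanLogSU (n := Fin N))) k U₀) c) c' * (avgFun (expMeanLogSU (n := Fin N)) ((Averaging.iter (fun i => blockAvg (P := F.P K) (j := i) (expMeanLogSU (n := Fin N))) k U₀)) c')⁻¹)) 0) (Xd k)))) ((bondShift (F.sitesPerDir_eq (m := F.m) (K := K) (j := (k + 1 + ((k + 1) - 1 - k))) (m' := F.m) (K' := K) (j' := (k + 1)) (by omega))).symm c)) else (0 : PBond (F.P K) (k + 1) → (specialUnitaryLogChart (Fin N)).lie)) = (Xd (k + 1) - (fderiv ℝ (fun (B : PBond (F.P K) k → (specialUnitaryLogChart (Fin N)).lie) (c' : PBond (F.P K) (k + 1)) => (isChartRep_specialUnitaryGroup (n := Fin N)).logChart (avgFun (expMeanLogSU (n := Fin N)) (fun c =>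 (isChartRep_specialUnitaryGroup (n := Fin N)).expChart (B c) * (Averaging.iter (fun i => blockAvg (P := F.P K) (j := i) (expMeanLogSU (n := Fin N))) k U₀) c) c' * (avgFun (expMeanLogSU (n := Fin N)) ((Averaging.iter (fun i => blockAvg (P := F.P K) (j := i) (expMeanLogSU (n := Fin N))) k U₀)) c')⁻¹)) 0) (Xd k)) := by
  have hkk : k < k + 1 := Nat.lt_succ_self k
  rw [dif_pos hkk]
  funext c
  exact seg_zero_symm_apply F (j := k + 1) (n := k + 1 - 1 - k) (by omega) hk ((Averaging.iter (fun i => blockAvg (P := F.P K) (j := i) (expMeanLogSU (n := Fin N))) (k + 1) U₀)) _ _ c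

/-! ## §2 The sum identity -/

/-- ★★ **THE SUM IDENTITY** `Xd k − DΨ^{U₀}_k (Xd 0) = Σ_{i<k} rterm i k` (top-peeling telescope by ascending induction). [cite: Balaban1985Averaging, Prop. 4 (128)-(131) pp.37-38] -/
theorem sub_fderiv_chartRead_iter_eq_sum {K : ℕ} (U₀ : GaugeField (F.P K) 0 (SU N)) {α : ℕ → ℝ} (hαδ : ∀ l, α l < deltaSU (Fin N))
    (Xd : (i : ℕ) → (PBond (F.P K) i → (specialUnitaryLogChart (Fin N)).lie)) (k : ℕ) :
    k ≤ F.m + K → (∀ l, l < k → ∀ (c : PBond (F.P K) (l + 1)) (idx : Idx (F.P K)), dist1 (loopHol (Averaging.iter (fun i => blockAvg (P := F.P K) (j := i) (expMeanLogSU (n := Fin N))) l U₀) c idx) ≤ α l) →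
      (Xd k - (fderiv ℝ (fun (A : PBond (F.P K) 0 → (specialUnitaryLogChart (Fin N)).lie) (c : PBond (F.P K) k) => (isChartRep_specialUnitaryGroup (n := Fin N)).logChart (Averaging.iter (fun i => blockAvg (P := F.P K) (j := i) (expMeanLogSU (n := Fin N))) k (fun b => (isChartRep_specialUnitaryGroup (n := Fin N)).expChart (A b) * U₀ b) c * (Averaging.iter (fun i => blockAvg (P := F.P K) (j := i) (expMeanLogSU (n := Fin N))) k U₀ c)⁻¹)) 0) (Xd 0)) = ∑ i ∈ Finset.range k, (if _h : i < k then (fun c : PBond (F.P K) k => ((fderiv ℝ (fun (A : PBond (F.P K) (i + 1) → (specialUnitaryLogChart (Fin N)).lie) (c : PBond (F.P K) ((i + 1) + (k - 1 - i))) => (isChartRep_specialUnitaryGroup (n := Fin N)).logChart (iterFrom (fun i => blockAvg (P := F.P K) (j := i) (expMeanLogSU (n := Fin N))) (i + 1) (k - 1 - i) (fun b : PBond (F.P K) (i + 1) => (isChartRep_specialUnitaryGroup (n := Fin N)).expChart (A b) * (Averaging.iter (fun i => blockAvg (P := F.P K) (j := i) (expMeanLogSU (n := Fin N))) (i + 1)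 U₀) b) c * (iterFrom (fun i => blockAvg (P := F.P K) (j := i) (expMeanLogSU (n := Fin N))) (i + 1) (k - 1 - i) ((Averaging.iter (fun i => blockAvg (P := F.P K) (j := i) (expMeanLogSU (n := Fin N))) (i + 1) U₀)) c)⁻¹)) 0) ((Xd (i + 1) - (fderiv ℝ (fun (B : PBond (F.P K) i → (specialUnitaryLogChart (Fin N)).lie) (c' : PBond (F.P K) (i + 1)) => (isChartRep_specialUnitaryGroup (n := Fin N)).logChart (avgFun (expMeanLogSU (n := Fin N)) (fun c => (isChartRep_specialUnitaryGroup (n := Fin N)).expChart (B c) * (Averaging.iter (fun i => blockAvg (P := F.P K) (j := i) (expMeanLogSU (n := Fin N))) i U₀) c) c' * (avgFun (expMeanLogSU (n := Fin N)) ((Averaging.iter (fun i => blockAvg (P := F.P K) (j := i) (expMeanLogSU (n := Fin N))) i U₀)) c')⁻¹)) 0) (Xd i)))) ((bondShift (F.sitesPerDir_eq (m := F.m) (K := K) (j := (i + 1 + (k - 1 - i))) (m' := F.m) (K' := K) (j' := k) (by omega))).symm c)) else (0 : PBond (F.P K) k → (specialUnitaryLogChart (Fin N)).lie)) := by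
  induction k with
  | zero =>
    intro _ _
    rw [fderiv_chartRead_iter_zero, ContinuousLinearMap.id_apply, sub_self, Finset.range_zero, Finset.sum_empty]
  | succ k IHk =>
    intro hk hαU
    have IH := IHk (by omega) (fun l hl => hαU l (by omega))
    have hsbU : SmallBelow (fun i => blockAvg (P := F.P K) (j := i) (expMeanLogSU (n := Fin N))) (k + 1) U₀ := smallBelow_of_guards F U₀ hαδ hαU
    rw [fderiv_chartRead_iter_succ_apply (P := F.P K) (N := N) U₀ k hsbU (Xd 0)]
    -- `x − A z = (x − A y) + A (y − z)`
    have hsplit : Xd (k + 1) - (fderiv ℝ (fun (B : PBond (F.P K) k → (specialUnitaryLogChart (Fin N)).lie) (c' : PBond (F.P K) (k + 1)) => (isChartRep_specialUnitaryGroup (n := Fin N)).logChart (avgFun (expMeanLogSU (n := Fin N)) (fun c => (isChartRep_specialUnitaryGroup (n := Fin N)).expChart (B c) * (Averaging.iter (fun i => blockAvg (P := F.P K) (j := i) (expMeanLogSU (n := Fin N))) k U₀) c) c' * (avgFun (expMeanLogSU (n := Fin N)) ((Averaging.iter (fun i => blockAvg (P := F.P K) (j := i) (expMeanLogSU (n :=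 Fin N))) k U₀)) c')⁻¹)) 0) ((fderiv ℝ (fun (A : PBond (F.P K) 0 → (specialUnitaryLogChart (Fin N)).lie) (c : PBond (F.P K) k) => (isChartRep_specialUnitaryGroup (n := Fin N)).logChart (Averaging.iter (fun i => blockAvg (P := F.P K) (j := i) (expMeanLogSU (n := Fin N))) k (fun b => (isChartRep_specialUnitaryGroup (n := Fin N)).expChart (A b) * U₀ b) c * (Averaging.iter (fun i => blockAvg (P := F.P K) (j := i) (expMeanLogSU (n := Fin N))) k U₀ c)⁻¹)) 0) (Xd 0)) =
        (fderiv ℝ (fun (B : PBond (F.P K) k → (specialUnitaryLogChart (Fin N)).lie) (c' : PBond (F.P K) (k + 1)) => (isChartRep_specialUnitaryGroup (n := Fin N)).logChart (avgFun (expMeanLogSU (n := Fin N)) (fun c => (isChartRep_specialUnitaryGroup (n := Fin N)).expChart (B c) * (Averaging.iter (fun i => blockAvg (P := F.P K) (j := i) (expMeanLogSU (n := Fin N))) k U₀) c) c' * (avgFun (expMeanLogSU (n := Fin N)) ((Averaging.iter (fun i => blockAvg (P := F.P K) (j := i) (expMeanLogSU (n := Fin N))) k U₀)) c')⁻¹))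 0) (Xd k - (fderiv ℝ (fun (A : PBond (F.P K) 0 → (specialUnitaryLogChart (Fin N)).lie) (c : PBond (F.P K) k) => (isChartRep_specialUnitaryGroup (n := Fin N)).logChart (Averaging.iter (fun i => blockAvg (P := F.P K) (j := i) (expMeanLogSU (n := Fin N))) k (fun b => (isChartRep_specialUnitaryGroup (n := Fin N)).expChart (A b) * U₀ b) c * (Averaging.iter (fun i => blockAvg (P := F.P K) (j := i) (expMeanLogSU (n := Fin N))) k U₀ c)⁻¹)) 0) (Xd 0)) + (Xd (k + 1) - (fderiv ℝ (fun (B : PBond (F.P K) k → (specialUnitaryLogChart (Fin N)).lie) (c' : PBond (F.P K) (k + 1)) => (isChartRep_specialUnitaryGroup (n := Fin N)).logChart (avgFun (expMeanLogSU (n := Fin N)) (fun c => (isChartRep_specialUnitaryGroup (n := Fin N)).expChart (B c) * (Averaging.iter (fun i => blockAvg (P := F.P K) (j := i) (expMeanLogSU (n := Fin N))) k U₀) c) c' * (avgFun (expMeanLogSU (n := Fin N)) ((Averaging.iter (fun i => blockAvg (P := F.P K) (j := i) (expMeanLogSU (n := Fin N))) k U₀)) c')⁻¹)) 0) (Xd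 k)) := by
      rw [map_sub, sub_add_sub_cancel']
    have hsum : ∑ i ∈ Finset.range k, (fderiv ℝ (fun (B : PBond (F.P K) k → (specialUnitaryLogChart (Fin N)).lie) (c' : PBond (F.P K) (k + 1)) => (isChartRep_specialUnitaryGroup (n := Fin N)).logChart (avgFun (expMeanLogSU (n := Fin N)) (fun c => (isChartRep_specialUnitaryGroup (n := Fin N)).expChart (B c) * (Averaging.iter (fun i => blockAvg (P := F.P K) (j := i) (expMeanLogSU (n := Fin N))) k U₀) c) c' * (avgFun (expMeanLogSU (n := Fin N)) ((Averaging.iter (fun i => blockAvg (P := F.P K) (j := i) (expMeanLogSU (n := Fin N))) k U₀)) c')⁻¹)) 0) ((if _h : i < k then (fun c : PBond (F.P K) k => ((fderiv ℝ (fun (A : PBond (F.P K) (i + 1) → (specialUnitaryLogChart (Fin N)).lie) (c : PBond (F.P K) ((i + 1) + (k - 1 - i))) => (isChartRep_specialUnitaryGroup (n := Fin N)).logChart (iterFrom (fun i => blockAvg (P := F.P K) (j := i) (expMeanLogSU (n := Fin N))) (i + 1) (k - 1 - i) (fun b : PBond (F.P K) (i + 1) => (isChartRep_specialUnitaryGroup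 (n := Fin N)).expChart (A b) * (Averaging.iter (fun i => blockAvg (P := F.P K) (j := i) (expMeanLogSU (n := Fin N))) (i + 1) U₀) b) c * (iterFrom (fun i => blockAvg (P := F.P K) (j := i) (expMeanLogSU (n := Fin N))) (i + 1) (k - 1 - i) ((Averaging.iter (fun i => blockAvg (P := F.P K) (j := i) (expMeanLogSU (n := Fin N))) (i + 1) U₀)) c)⁻¹)) 0) ((Xd (i + 1) - (fderiv ℝ (fun (B : PBond (F.P K) i → (specialUnitaryLogChart (Fin N)).lie) (c' : PBond (F.P K) (i + 1)) => (isChartRep_specialUnitaryGroup (n := Fin N)).logChart (avgFun (expMeanLogSU (n := Fin N)) (fun c => (isChartRep_specialUnitaryGroup (n := Fin N)).expChart (B c) * (Averaging.iter (fun i => blockAvg (P := F.P K) (j := i) (expMeanLogSU (n := Fin N))) i U₀) c) c' * (avgFun (expMeanLogSU (n := Fin N)) ((Averaging.iter (fun i => blockAvg (P := F.P K) (j := i) (expMeanLogSU (n := Fin N))) i U₀)) c')⁻¹)) 0) (Xd i)))) ((bondShift (F.sitesPerDir_eq (m := F.m) (K := K) (j := (i + 1 + (k - 1 - i))) (m'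 := F.m) (K' := K) (j' := k) (by omega))).symm c)) else (0 : PBond (F.P K) k → (specialUnitaryLogChart (Fin N)).lie))) = ∑ i ∈ Finset.range k, (if _h : i < (k + 1) then (fun c : PBond (F.P K) (k + 1) => ((fderiv ℝ (fun (A : PBond (F.P K) (i + 1) → (specialUnitaryLogChart (Fin N)).lie) (c : PBond (F.P K) ((i + 1) + ((k + 1) - 1 - i))) => (isChartRep_specialUnitaryGroup (n := Fin N)).logChart (iterFrom (fun i => blockAvg (P := F.P K) (j := i) (expMeanLogSU (n := Fin N))) (i + 1) ((k + 1) - 1 - i) (fun b : PBond (F.P K) (i + 1) => (isChartRep_specialUnitaryGroup (n := Fin N)).expChart (A b) * (Averaging.iter (fun i => blockAvg (P := F.P K) (j := i) (expMeanLogSU (n := Fin N))) (i + 1) U₀) b) c * (iterFrom (fun i => blockAvg (P := F.P K) (j := i) (expMeanLogSU (n := Fin N))) (i + 1) ((k + 1) - 1 - i) ((Averaging.iter (fun i => blockAvg (P := F.P K) (j := i) (expMeanLogSU (n := Fin N))) (i + 1) U₀)) c)⁻¹)) 0) ((Xd (i + 1) - (fderiv ℝ (fun (B : PBond (F.P K)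 i → (specialUnitaryLogChart (Fin N)).lie) (c' : PBond (F.P K) (i + 1)) => (isChartRep_specialUnitaryGroup (n := Fin N)).logChart (avgFun (expMeanLogSU (n := Fin N)) (fun c => (isChartRep_specialUnitaryGroup (n := Fin N)).expChart (B c) * (Averaging.iter (fun i => blockAvg (P := F.P K) (j := i) (expMeanLogSU (n := Fin N))) i U₀) c) c' * (avgFun (expMeanLogSU (n := Fin N)) ((Averaging.iter (fun i => blockAvg (P := F.P K) (j := i) (expMeanLogSU (n := Fin N))) i U₀)) c')⁻¹)) 0) (Xd i)))) ((bondShift (F.sitesPerDir_eq (m := F.m) (K := K) (j := (i + 1 + ((k + 1) - 1 - i))) (m' := F.m) (K' := K) (j' := (k + 1)) (by omega))).symm c)) else (0 : PBond (F.P K) (k + 1) → (specialUnitaryLogChart (Fin N)).lie)) :=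
      Finset.sum_congr rfl (fun i hi => rterm_top F hk (Finset.mem_range.1 hi) U₀ hαδ hαU Xd)
    rw [hsplit, IH, map_sum, Finset.sum_range_succ, hsum, rterm_diag F hk U₀ Xd]

/-! ## §3 The second-order sup remainder of the k-step tower -/

/-- ★★★ **THE SECOND-ORDER SUP REMAINDER OF THE k-STEP TOWER, CLOSED FORM** (px13 g29's ✓p840433 shape, instantiated): under the loop `α`-guards below `k` (`0 ≤ α_l ≤ 1∕24`,
`α_l < δ_N`, `k ≤ m + K`) and one-step second-order remainders `‖↑(Xd (i+1) c′) − ↑(Dψ_{Ū^iU₀}(Xd i) c′)‖ ≤ r (i+1)` (`0 ≤ r`):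
**`‖↑(Xd k c) − ↑(DΨ^{U₀}_k (Xd 0) c)‖ ≤ Σ_{i<k} Λ·L^{k−1−i}·r(i+1)`**, `Λ = (1+4(d+2))·exp((d+2)(422+1616(d+2))·Σ_{j<k} α_j)` (SEGMENT rows ✓p840392 — K-uniform).
[cite: Balaban1985Averaging, Prop. 4 (128)-(131) pp.37-38; Balaban1987RG1, (0.11) p.253] -/
theorem norm_sub_fderiv_chartRead_iter_le {K k : ℕ} (hk : k ≤ F.m + K) (U₀ : GaugeField (F.P K) 0 (SU N)) {α r : ℕ → ℝ}
    (hα0 : ∀ l, 0 ≤ α l) (hα24 : ∀ l, α l ≤ 1 / 24) (hαδ : ∀ l, α l < deltaSU (Fin N)) (hr0 : ∀ l, 0 ≤ r l)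
    (hαU : (∀ l, l < k → ∀ (c : PBond (F.P K) (l + 1)) (idx : Idx (F.P K)), dist1 (loopHol (Averaging.iter (fun i => blockAvg (P := F.P K) (j := i) (expMeanLogSU (n := Fin N))) l U₀) c idx) ≤ α l))
    (Xd : (i : ℕ) → (PBond (F.P K) i → (specialUnitaryLogChart (Fin N)).lie))
    (hr : ∀ i, i < k → ∀ c' : PBond (F.P K) (i + 1),
      ‖((Xd (i + 1) c' : (specialUnitaryLogChart (Fin N)).lie) : Matrix (Fin N) (Fin N) ℂ) - (((fderiv ℝ (fun (B : PBond (F.P K) i → (specialUnitaryLogChart (Fin N)).lie) (c' : PBond (F.P K) (i + 1)) => (isChartRep_specialUnitaryGroup (n := Fin N)).logChart (avgFun (expMeanLogSU (n := Fin N)) (fun c => (isChartRep_specialUnitaryGroup (n := Fin N)).expChart (B c) * (Averaging.iter (fun i => blockAvg (P := F.P K) (j := i) (expMeanLogSU (n := Fin N))) i U₀) c) c' * (avgFun (expMeanLogSU (n := Fin N)) ((Averaging.iter (fun i => blockAvg (P := F.P K) (j := i) (expMeanLogSU (n := Fin N))) i U₀)) c')⁻¹)) 0) (Xd i) c' : (specialUnitaryLogChart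 (Fin N)).lie) : Matrix (Fin N) (Fin N) ℂ)‖ ≤ r (i + 1))
    (c : PBond (F.P K) k) :
    ‖((Xd k c : (specialUnitaryLogChart (Fin N)).lie) : Matrix (Fin N) (Fin N) ℂ) - (((fderiv ℝ (fun (A : PBond (F.P K) 0 → (specialUnitaryLogChart (Fin N)).lie) (c : PBond (F.P K) k) => (isChartRep_specialUnitaryGroup (n := Fin N)).logChart (Averaging.iter (fun i => blockAvg (P := F.P K) (j := i) (expMeanLogSU (n := Fin N))) k (fun b => (isChartRep_specialUnitaryGroup (n := Fin N)).expChart (A b) * U₀ b) c * (Averaging.iter (fun i => blockAvg (P := F.P K) (j := i) (expMeanLogSU (n := Fin N))) k U₀ c)⁻¹)) 0) (Xd 0) c : (specialUnitaryLogChart (Fin N)).lie) : Matrix (Fin N) (Fin N) ℂ)‖ ≤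
      ∑ i ∈ Finset.range k, ((1 + 4 * (((F.P K).d + 2 : ℕ) : ℝ)) * Real.exp ((((F.P K).d + 2 : ℕ) : ℝ) * (422 + 1616 * (((F.P K).d + 2 : ℕ) : ℝ)) * ∑ j ∈ Finset.range k, α j)) * ((F.P K).L : ℝ) ^ (k - 1 - i) * r (i + 1) := by
  have hid := congrFun (sub_fderiv_chartRead_iter_eq_sum F U₀ hαδ Xd k hk hαU) c
  rw [Pi.sub_apply, Finset.sum_apply] at hid
  rw [← Submodule.coe_sub, Submodule.norm_coe, hid]
  refine (norm_sum_le _ _).trans (Finset.sum_le_sum fun i hi => ?_)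
  rw [Finset.mem_range] at hi
  rw [dif_pos hi]
  have hrow := norm_fderiv_chartReadFrom_apply_le_exp (N := N) F (K := K) (k₀ := i + 1) (n := k - 1 - i) (by omega) ((Averaging.iter (fun i => blockAvg (P := F.P K) (j := i) (expMeanLogSU (n := Fin N))) (i + 1) U₀))
    ((Xd (i + 1) - (fderiv ℝ (fun (B : PBond (F.P K) i → (specialUnitaryLogChart (Fin N)).lie) (c' : PBond (F.P K) (i + 1)) => (isChartRep_specialUnitaryGroup (n := Fin N)).logChart (avgFun (expMeanLogSU (n := Fin N)) (fun c => (isChartRep_specialUnitaryGroup (n := Fin N)).expChart (B c) * (Averaging.iter (fun i => blockAvg (P := F.P K) (j := i) (expMeanLogSU (n := Fin N))) i U₀) c) c' * (avgFun (expMeanLogSU (n := Fin N)) ((Averaging.iter (fun i => blockAvg (P := F.P K) (j := i) (expMeanLogSU (n := Fin N))) i U₀)) c')⁻¹)) 0) (Xd i))) (α := fun j => α (i + 1 + j)) (fun j => hα0 _) (fun j => hα24 _) (fun j => hαδ _)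
    (fun j hj c' idx => by
      rw [← iter_add]
      exact hαU (i + 1 + j) (by omega) c' idx)
    ((bondShift (F.sitesPerDir_eq (m := F.m) (K := K) (j := (i + 1 + (k - 1 - i))) (m' := F.m) (K' := K) (j' := k) (by omega))).symm c)
  rw [← Submodule.norm_coe]
  refine hrow.trans ?_
  have hR : ‖(Xd (i + 1) - (fderiv ℝ (fun (B : PBond (F.P K) i → (specialUnitaryLogChart (Fin N)).lie) (c' : PBond (F.P K) (i + 1)) => (isChartRep_specialUnitaryGroup (n := Fin N)).logChart (avgFun (expMeanLogSU (n := Fin N)) (fun c => (isChartRep_specialUnitaryGroup (n := Fin N)).expChart (B c) * (Averaging.iter (fun i => blockAvg (P := F.P K) (j := i) (expMeanLogSU (n := Fin N))) i U₀) c) c' * (avgFun (expMeanLogSU (n := Fin N)) ((Averaging.iter (fun i => blockAvg (P := F.P K) (j := i) (expMeanLogSU (n := Fin N))) i U₀)) c')⁻¹)) 0) (Xd i))‖ ≤ r (i + 1) := by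
    refine (pi_norm_le_iff_of_nonneg (hr0 _)).2 fun c' => ?_
    rw [Pi.sub_apply, ← Submodule.norm_coe, Submodule.coe_sub]
    exact hr i hi c'
  have hΛ1 : ((1 + 4 * (((F.P K).d + 2 : ℕ) : ℝ)) * Real.exp ((((F.P K).d + 2 : ℕ) : ℝ) * (422 + 1616 * (((F.P K).d + 2 : ℕ) : ℝ)) * ∑ j ∈ Finset.range (k - 1 - i), (fun j => α (i + 1 + j)) j)) ≤ ((1 + 4 * (((F.P K).d + 2 : ℕ) : ℝ)) * Real.exp ((((F.P K).d + 2 : ℕ) : ℝ) * (422 + 1616 * (((F.P K).d + 2 : ℕ) : ℝ)) * ∑ j ∈ Finset.range k, α j)) :=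
    rowConst_mono F (sum_shift_le hα0 (i := i) (n := k - 1 - i) (k := k) (by omega))
  have hL0 : (0 : ℝ) ≤ ((F.P K).L : ℝ) ^ (k - 1 - i) := by positivity
  exact mul_le_mul (mul_le_mul_of_nonneg_right hΛ1 hL0) hR (norm_nonneg _) (by positivity)

end Summit.QuantumFields.YangMills.Theorems.FluctuationComparisonRegPrIntLS2BetaSecondOrderTowerSupClosed

end
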